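import Literature.Analysis.UnboundedOperators.HeatKernelBoundedData
import Mathlib.Analysis.Calculus.LineDeriv.IntegrationByParts
import Mathlib.Analysis.Calculus.Gradient.Basic
import HarnessLib

/-!
# Gaussian integration by parts (Stein's identity) for the heat kernel measure

Analysis/UnboundedOperators support file (all results proved, no definitions, no named facts) on
the path to the Gaussian Poincaré inequality for the heat-kernel measure `G_t(x) dx`
(`heatKernel t`, the Gauss–Weierstrass kernel `(4πt)^{-n/2} e^{−|x|²/4t}` of a finite-dimensional
real inner product space), wanted for the linear theory (spectral gap of
`L = Δ + ½x·∇ + 1` in `L²(G⁻¹dx)`) behind the named facts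
`Literature.Analysis.FluidPDE.GallayWayne2006_thm11` / `GallayMaekawa2016_thm41`
(`Analysis/FluidPDE/GaussianVortexPlanar`: there `G = heatKernel 1` on `ℝ²`).

* `inner_mul_heatKernel_eq`: `⟪z, v⟫ G_t(z) = −2t ∂ᵥG_t(z)`;
* `integral_inner_mul_mul_heatKernel` — **Stein's identity / Gaussian integration by parts**:
  for `g ∈ C¹(E)` with `g` and `Dg` bounded, `0 < t`, `v ∈ E`,
  `∫ ⟪z, v⟫ g(z) G_t(z) dz = 2t ∫ ∂ᵥg(z) G_t(z) dz`
  (the covariance of `G_t(x)dx` is `2t·Id`). Proof: `⟪z,v⟫G_t = −2t∂ᵥG_t` and one integration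
  by parts on the whole space (`integral_mul_fderiv_eq_neg_fderiv_mul_of_integrable`; no
  boundary terms since every product is integrable).

## References

* C. Stein, *Approximate Computation of Expectations*, IMS Lecture Notes 7 (1986), Lemma II.1
  (Stein's identity `E[Xg(X)] = σ²E[g'(X)]`).
* D. Bakry, I. Gentil, M. Ledoux, *Analysis and Geometry of Markov Diffusion Operators*,
  Springer 2014, §4.1 (Gaussian Poincaré inequality). [folklore]
-/

open MeasureTheory Filter Topology Set InnerProductSpace Metric
open scoped Real RealInnerProductSpace

noncomputable section

namespace Literature.Analysis.UnboundedOperators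

section Stein

variable {E : Type*} [NormedAddCommGroup E] [InnerProductSpace ℝ E]

/-- `⟪z, v⟫ G_t(z) = −2t ∂ᵥG_t(z)` for `t ≠ 0`. [folklore] -/
theorem inner_mul_heatKernel_eq {t : ℝ} (ht : t ≠ 0) (z v : E) :
    ⟪z, v⟫ * heatKernel t z = -(2 * t) * fderiv ℝ (heatKernel t) z v := by
  rw [fderiv_heatKernel_apply_eq_mul_inner]
  field_simp

variable [FiniteDimensional ℝ E] [MeasurableSpace E] [BorelSpace E]

/-- **Stein's identity (Gaussian integration by parts) for the heat-kernel measure.** For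
`g ∈ C¹(E)` with `g` and `Dg` bounded, `0 < t` and `v ∈ E`:
`∫ ⟪z, v⟫ g(z) G_t(z) dz = 2t ∫ ∂ᵥg(z) G_t(z) dz`. [folklore] -/
theorem integral_inner_mul_mul_heatKernel {t : ℝ} (ht : 0 < t) {g : E → ℝ} (hg : ContDiff ℝ 1 g)
    {C₀ C₁ : ℝ} (h0 : ∀ z, ‖g z‖ ≤ C₀) (h1 : ∀ z, ‖fderiv ℝ g z‖ ≤ C₁) (v : E) :
    ∫ z, ⟪z, v⟫ * g z * heatKernel t z = 2 * t * ∫ z, fderiv ℝ g z v * heatKernel t z := by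
  have hK := integrable_heatKernel_holds (E := E) ht
  have hKd : ∀ z, DifferentiableAt ℝ (heatKernel (E := E) t) z := fun z =>
    (hasFDerivAt_heatKernel t z).differentiableAt
  have hgd : Differentiable ℝ g := hg.differentiable one_ne_zero
  have hgc : Continuous g := hg.continuous
  have hg'c : Continuous fun z => fderiv ℝ g z v :=
    (hg.continuous_fderiv one_ne_zero).clm_apply continuous_const
  have i1 : Integrable fun z => fderiv ℝ g z v * heatKernel t z :=
    hK.bdd_mul hg'c.aestronglyMeasurable (Eventually.of_forall fun z =>
      ((fderiv ℝ g z).le_opNorm v).trans (mul_le_mul_of_nonneg_right (h1 z) (norm_nonneg _)))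
  have i2 : Integrable fun z => g z * fderiv ℝ (heatKernel t) z v :=
    (integrable_fderiv_heatKernel_apply ht v).bdd_mul hgc.aestronglyMeasurable
      (Eventually.of_forall h0)
  have i3 : Integrable fun z => g z * heatKernel t z :=
    hK.bdd_mul hgc.aestronglyMeasurable (Eventually.of_forall h0)
  have hibp := integral_mul_fderiv_eq_neg_fderiv_mul_of_integrable i1 i2 i3
    (fun z _ => hgd z) (fun z _ => hKd z)
  calc ∫ z, ⟪z, v⟫ * g z * heatKernel t z
      = ∫ z, -(2 * t) * (g z * fderiv ℝ (heatKernel t) z v) := by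
        congr 1; funext z
        rw [mul_comm ⟪z, v⟫ (g z), mul_assoc, inner_mul_heatKernel_eq ht.ne']
        ring
    _ = -(2 * t) * ∫ z, g z * fderiv ℝ (heatKernel t) z v := integral_const_mul _ _
    _ = 2 * t * ∫ z, fderiv ℝ g z v * heatKernel t z := by rw [hibp]; ring

/-- Stein's identity with the gradient: `∫ ⟪z, v⟫ g G_t = 2t ∫ ⟪∇g, v⟫ G_t`. [folklore] -/
theorem integral_inner_mul_mul_heatKernel_eq_gradient {t : ℝ} (ht : 0 < t) {g : E → ℝ}
    (hg : ContDiff ℝ 1 g) {C₀ C₁ : ℝ} (h0 : ∀ z, ‖g z‖ ≤ C₀) (h1 : ∀ z, ‖fderiv ℝ g z‖ ≤ C₁)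
    [CompleteSpace E] (v : E) :
    ∫ z, ⟪z, v⟫ * g z * heatKernel t z = 2 * t * ∫ z, ⟪gradient g z, v⟫ * heatKernel t z := by
  rw [integral_inner_mul_mul_heatKernel ht hg h0 h1 v]
  congr 1
  refine integral_congr_ae (Eventually.of_forall fun z => ?_)
  simp only [gradient, InnerProductSpace.toDual_symm_apply]

end Stein

end Literature.Analysis.UnboundedOperators
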